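import Summits.ValiantsHypothesis.ValiantsHypothesis.Theorems.SymPencilPerFourPeeledHessian

/-!
# Route `SymPencil` — inner rank of the `2 | 2` row split of `per_4`, PEELED case: the Hessian
# pencil witnesses for the RESIDUAL patterns of the row-`𝟙` coefficient vector `h`
# (`--supports` stmt-ValiantsHypothesis-5674 `SdcSuperquadratic`; (8,8) column, memo
# `NOTE-p6g16-5674-R2-peeled-ten.md` §2)

When no three coordinates of `h = Ψᵀ𝟙` are pairwise distinct and non-zero, `h` is, up to a
coordinate permutation and the rescaling `v₀ ↦ λ v₀`, one of
`(1,0,0,0)`, `(1,c,0,0)` (`c ≠ 0, −1`), `(1,−1,0,0)`, `(1,1,c,0)` (`c ≠ 0`), `(1,1,1,1)`,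
`(1,1,1,c)` (`c ≠ 1`), `(1,1,c,c)` (`c ≠ 1`).  For each we give explicit `y₀, y₁ ∈ h^⟂` with
`𝐇(y₀) = [per(𝟙;e_b;y₀;e_l)]` invertible and an explicit (scaled) Krylov chain
`𝐇(y₀) u_{k+1} = det 𝐇(y₀) · 𝐇(y₁) u_k` whose four vectors form a basis; by the scaled
Taussky–Zassenhaus chain criterion (`eq_zero_of_pencil_chain_smul`, a variant of
`…PeeledTZ.eq_zero_of_pencil_chain`) the pencil `𝐇(y₀)⁻¹𝐇(y₁)` has the TZ property.  All data were
found and verified in exact arithmetic (seat folder `scratch/gen_resid.py`).  Output shape = that of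
`…PeeledHessian.htz_caseA`, consumed by `…PeeledTenCaseA.false_of_peeled_ten_of_witness`.
Honest framing: helper lemmas; no cell closes; `27 ≤ sdc(per_4) ≤ 29`, the crux and `VP ≠ VNP`
untouched.  No definitions, no named facts. [folklore]
-/

noncomputable section

-- single-conjunct layout: Sub = Summit, duplicated namespace component intended
set_option linter.dupNamespace false

namespace Summit.ValiantsHypothesis.ValiantsHypothesis.Theorems.SymPencilPerFourPeeledResidual

open Matrix Finset
open Summit.ValiantsHypothesis.ValiantsHypothesis.Theorems.SymPencilPerFourInnerRankRows
open Summit.ValiantsHypothesis.ValiantsHypothesis.Theorems.SymPencilPerFourPeeledTZ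
open Summit.ValiantsHypothesis.ValiantsHypothesis.Theorems.SymPencilPerFourPeeledHessian

variable {K : Type*} [Field K]

/-- **Scaled Krylov-chain form of the Taussky–Zassenhaus criterion.**  As
`…PeeledTZ.eq_zero_of_pencil_chain`, with the chain `P₀ u_{k+1} = d • P₁ u_k` for a fixed non-zero
scalar `d` (so that the chain vectors can be kept polynomial). [folklore] -/
theorem eq_zero_of_pencil_chain_smul [CharZero K] (A S P₀ P₁ : Matrix (Fin 4) (Fin 4) K)
    (hA : Aᵀ = -A) (hAS : A * S = Sᵀ * A) (hP : P₀ * S = P₁) (W₀ : Matrix (Fin 4) (Fin 4) K)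
    (hW₀ : W₀ * P₀ = 1) (d : K) (hd : d ≠ 0) (u : Fin 4 → Fin 4 → K)
    (h1 : P₀ *ᵥ u 1 = d • P₁ *ᵥ u 0) (h2 : P₀ *ᵥ u 2 = d • P₁ *ᵥ u 1)
    (h3 : P₀ *ᵥ u 3 = d • P₁ *ᵥ u 2)
    (W : Matrix (Fin 4) (Fin 4) K) (hW : W * Matrix.of u = 1) : A = 0 := by
  have key : ∀ x y : Fin 4 → K, P₀ *ᵥ x = d • P₁ *ᵥ y → x = d • S *ᵥ y := by
    intro x y h
    have : W₀ *ᵥ (P₀ *ᵥ x) = W₀ *ᵥ (d • P₁ *ᵥ y) := by rw [h]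
    rwa [mulVec_smul, mulVec_mulVec, mulVec_mulVec, hW₀, one_mulVec, ← hP, ← Matrix.mul_assoc,
      hW₀, Matrix.one_mul] at this
  have k1 := key _ _ h1
  have k2 := key _ _ h2
  have k3 := key _ _ h3
  -- rescale: `u' k = d^{-k} • u k` is an honest Krylov chain
  let u' : Fin 4 → Fin 4 → K := ![u 0, d⁻¹ • u 1, (d⁻¹ * d⁻¹) • u 2, (d⁻¹ * d⁻¹ * d⁻¹) • u 3]
  have hdinv : d⁻¹ * d = 1 := inv_mul_cancel₀ hd
  have h1' : u' 1 = S *ᵥ u' 0 := by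
    change d⁻¹ • u 1 = S *ᵥ u 0
    rw [k1, smul_smul, hdinv, one_smul]
  have h2' : u' 2 = S *ᵥ u' 1 := by
    change (d⁻¹ * d⁻¹) • u 2 = S *ᵥ (d⁻¹ • u 1)
    rw [k2, smul_smul, mulVec_smul, mul_assoc, hdinv, mul_one]
  have h3' : u' 3 = S *ᵥ u' 2 := by
    change (d⁻¹ * d⁻¹ * d⁻¹) • u 3 = S *ᵥ ((d⁻¹ * d⁻¹) • u 2)
    rw [k3, smul_smul, mulVec_smul, mul_assoc, hdinv, mul_one]
  -- a left inverse for the rescaled chain: `(W * diagonal (d^k)) * of u' = 1`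
  have hscale : Matrix.of u' = Matrix.diagonal ![1, d⁻¹, d⁻¹ * d⁻¹, d⁻¹ * d⁻¹ * d⁻¹] * Matrix.of u := by
    ext i j
    rw [Matrix.diagonal_mul]
    fin_cases i <;> simp [u']
  have hW' : (W * Matrix.diagonal ![1, d, d * d, d * d * d]) * Matrix.of u' = 1 := by
    rw [hscale, Matrix.mul_assoc, ← Matrix.mul_assoc (Matrix.diagonal _), Matrix.diagonal_mul_diagonal]
    have : (fun i => ![(1 : K), d, d * d, d * d * d] i * ![1, d⁻¹, d⁻¹ * d⁻¹, d⁻¹ * d⁻¹ * d⁻¹] i) =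
        fun _ => 1 := by
      funext i; fin_cases i <;> simp <;> field_simp
    rw [this, Matrix.diagonal_one, Matrix.one_mul, hW]
  exact eq_zero_of_chain A S hA hAS u' h1' h2' h3' _ hW'

/-- Pattern `R1`: the explicit Hessian matrices `𝐇(y₀)`, `𝐇(y₁)`. [folklore] -/
theorem R1_mats (P₀ P₁ : Matrix (Fin 4) (Fin 4) K)
    (hP₀ : ∀ b l, P₀ b l = (Matrix.of ![(fun _ => (1 : K)), Pi.single b 1,
      ![(0 : K), ((1 : K)), ((1 : K)), ((1 : K))], Pi.single l 1]).permanent)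
    (hP₁ : ∀ b l, P₁ b l = (Matrix.of ![(fun _ => (1 : K)), Pi.single b 1,
      ![(0 : K), ((-1 : K)), ((-1 : K)), (0 : K)], Pi.single l 1]).permanent) :
    P₀ = !![(0 : K), ((2 : K)), ((2 : K)), ((2 : K)); ((2 : K)), (0 : K), ((1 : K)), ((1 : K)); ((2 : K)), ((1 : K)), (0 : K), ((1 : K)); ((2 : K)), ((1 : K)), ((1 : K)), (0 : K)] ∧
    P₁ = !![(0 : K), ((-1 : K)), ((-1 : K)), ((-2 : K)); ((-1 : K)), (0 : K), (0 : K), ((-1 : K)); ((-1 : K)), (0 : K), (0 : K), ((-1 : K)); ((-2 : K)), ((-1 : K)), ((-1 : K)), (0 : K)] := by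
  constructor
  · ext b l; rw [hP₀, per_one_single_single]
    fin_cases b <;> fin_cases l <;> simp <;> ring
  · ext b l; rw [hP₁, per_one_single_single]
    fin_cases b <;> fin_cases l <;> simp <;> ring

/-- Pattern `R1`: `det 𝐇(y₀)`. [folklore] -/
theorem R1_det :
    (!![(0 : K), ((2 : K)), ((2 : K)), ((2 : K)); ((2 : K)), (0 : K), ((1 : K)), ((1 : K)); ((2 : K)), ((1 : K)), (0 : K), ((1 : K)); ((2 : K)), ((1 : K)), ((1 : K)), (0 : K)] : Matrix (Fin 4) (Fin 4) K).det = ((-12 : K)) := by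
  rw [Matrix.det_succ_row_zero]
  simp [Fin.sum_univ_succ, Matrix.det_fin_three, Fin.succAbove]
  ring

/-- Pattern `R1`: scaled Krylov chain, step 1. [folklore] -/
theorem R1_c1 :
    (!![(0 : K), ((2 : K)), ((2 : K)), ((2 : K)); ((2 : K)), (0 : K), ((1 : K)), ((1 : K)); ((2 : K)), ((1 : K)), (0 : K), ((1 : K)); ((2 : K)), ((1 : K)), ((1 : K)), (0 : K)] : Matrix (Fin 4) (Fin 4) K) *ᵥ ![((8 : K)), ((34 : K)), ((34 : K)), ((10 : K))]
      = ((-12 : K)) • (!![(0 : K), ((-1 : K)), ((-1 : K)), ((-2 : K)); ((-1 : K)), (0 : K), (0 : K), ((-1 : K)); ((-1 : K)), (0 : K), (0 : K), ((-1 : K)); ((-2 : K)), ((-1 : K)), ((-1 : K)), (0 : K)] : Matrix (Fin 4) (Fin 4) K) *ᵥ ![((1 : K)), ((2 : K)), ((3 : K)), ((4 : K))] := by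
  ext i; fin_cases i <;> simp
  all_goals ring

/-- Pattern `R1`: scaled Krylov chain, step 2. [folklore] -/
theorem R1_c2 :
    (!![(0 : K), ((2 : K)), ((2 : K)), ((2 : K)); ((2 : K)), (0 : K), ((1 : K)), ((1 : K)); ((2 : K)), ((1 : K)), (0 : K), ((1 : K)); ((2 : K)), ((1 : K)), ((1 : K)), (0 : K)] : Matrix (Fin 4) (Fin 4) K) *ᵥ ![((64 : K)), ((440 : K)), ((440 : K)), ((-352 : K))]
      = ((-12 : K)) • (!![(0 : K), ((-1 : K)), ((-1 : K)), ((-2 : K)); ((-1 : K)), (0 : K), (0 : K), ((-1 : K)); ((-1 : K)), (0 : K), (0 : K), ((-1 : K)); ((-2 : K)), ((-1 : K)), ((-1 : K)), (0 : K)] : Matrix (Fin 4) (Fin 4) K) *ᵥ ![((8 : K)), ((34 : K)), ((34 : K)), ((10 : K))] := by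
  ext i; fin_cases i <;> simp
  all_goals ring

/-- Pattern `R1`: scaled Krylov chain, step 3. [folklore] -/
theorem R1_c3 :
    (!![(0 : K), ((2 : K)), ((2 : K)), ((2 : K)); ((2 : K)), (0 : K), ((1 : K)), ((1 : K)); ((2 : K)), ((1 : K)), (0 : K), ((1 : K)); ((2 : K)), ((1 : K)), ((1 : K)), (0 : K)] : Matrix (Fin 4) (Fin 4) K) *ᵥ ![((512 : K)), ((5536 : K)), ((5536 : K)), ((-10016 : K))]
      = ((-12 : K)) • (!![(0 : K), ((-1 : K)), ((-1 : K)), ((-2 : K)); ((-1 : K)), (0 : K), (0 : K), ((-1 : K)); ((-1 : K)), (0 : K), (0 : K), ((-1 : K)); ((-2 : K)), ((-1 : K)), ((-1 : K)), (0 : K)] : Matrix (Fin 4) (Fin 4) K) *ᵥ ![((64 : K)), ((440 : K)), ((440 : K)), ((-352 : K))] := by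
  ext i; fin_cases i <;> simp
  all_goals ring

/-- Pattern `R1`: the Krylov vectors form a basis. [folklore] -/
theorem R1_kdet :
    (Matrix.of ![![((1 : K)), ((2 : K)), ((3 : K)), ((4 : K))], ![((8 : K)), ((34 : K)), ((34 : K)), ((10 : K))],
      ![((64 : K)), ((440 : K)), ((440 : K)), ((-352 : K))],
      ![((512 : K)), ((5536 : K)), ((5536 : K)), ((-10016 : K))]] : Matrix (Fin 4) (Fin 4) K).det
      = ((-2709504 : K)) := by
  rw [Matrix.det_succ_row_zero]
  simp [Fin.sum_univ_succ, Matrix.det_fin_three, Fin.succAbove]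
  ring

/-- **Residual pattern `R1`**: h = (1*c^0, 0, 0, 0) — pencil witnesses
`y₀ = ![(0 : K), ((1 : K)), ((1 : K)), ((1 : K))]`, `y₁ = ![(0 : K), ((-1 : K)), ((-1 : K)), (0 : K)]` (memo §2). [folklore] -/
theorem htz_R1 [CharZero K] (h : Fin 4 → K)
    (e1' : h 1 = 0) (e2' : h 2 = 0) (e3' : h 3 = 0)
    (P₀ P₁ : Matrix (Fin 4) (Fin 4) K)
    (hP₀ : ∀ b l, P₀ b l = (Matrix.of ![(fun _ => (1 : K)), Pi.single b 1,
      ![(0 : K), ((1 : K)), ((1 : K)), ((1 : K))], Pi.single l 1]).permanent)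
    (hP₁ : ∀ b l, P₁ b l = (Matrix.of ![(fun _ => (1 : K)), Pi.single b 1,
      ![(0 : K), ((-1 : K)), ((-1 : K)), (0 : K)], Pi.single l 1]).permanent) :
    (∑ k, ![(0 : K), ((1 : K)), ((1 : K)), ((1 : K))] k * h k = 0) ∧
    (∑ k, ![(0 : K), ((-1 : K)), ((-1 : K)), (0 : K)] k * h k = 0) ∧
    IsUnit P₀.det ∧
    (∀ A : Matrix (Fin 4) (Fin 4) K, Aᵀ = -A →
      A * (P₀⁻¹ * P₁) = (P₀⁻¹ * P₁)ᵀ * A → A = 0) := by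
  obtain ⟨e0, e1⟩ := R1_mats (K := K) P₀ P₁ hP₀ hP₁
  have hd : P₀.det = ((-12 : K)) := by rw [e0]; exact R1_det (K := K)
  have hunit : IsUnit P₀.det := by
    rw [hd, isUnit_iff_ne_zero]
    norm_num
  refine ⟨by simp [Fin.sum_univ_four, e1', e2', e3'], by simp [Fin.sum_univ_four, e1', e2', e3'], hunit, ?_⟩
  have hP0inv : P₀ * P₀⁻¹ = 1 := Matrix.mul_nonsing_inv P₀ hunit
  have hP0inv' : P₀⁻¹ * P₀ = 1 := Matrix.nonsing_inv_mul P₀ hunit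
  let u : Fin 4 → Fin 4 → K := ![![((1 : K)), ((2 : K)), ((3 : K)), ((4 : K))], ![((8 : K)), ((34 : K)), ((34 : K)), ((10 : K))],
    ![((64 : K)), ((440 : K)), ((440 : K)), ((-352 : K))],
    ![((512 : K)), ((5536 : K)), ((5536 : K)), ((-10016 : K))]]
  have c1 : P₀ *ᵥ u 1 = ((-12 : K)) • P₁ *ᵥ u 0 := by
    rw [e0, e1]; exact R1_c1 (K := K)
  have c2 : P₀ *ᵥ u 2 = ((-12 : K)) • P₁ *ᵥ u 1 := by
    rw [e0, e1]; exact R1_c2 (K := K)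
  have c3 : P₀ *ᵥ u 3 = ((-12 : K)) • P₁ *ᵥ u 2 := by
    rw [e0, e1]; exact R1_c3 (K := K)
  have hUunit : IsUnit (Matrix.of u).det := by
    have hD : (Matrix.of u).det = ((-2709504 : K)) := R1_kdet (K := K)
    rw [hD, isUnit_iff_ne_zero]
    norm_num
  intro A hA hAS
  exact eq_zero_of_pencil_chain_smul A (P₀⁻¹ * P₁) P₀ P₁ hA hAS
    (by rw [← Matrix.mul_assoc, hP0inv, Matrix.one_mul]) P₀⁻¹ hP0inv' ((-12 : K))
    (by rw [← hd]; exact hunit.ne_zero) u c1 c2 c3 (Matrix.of u)⁻¹ (Matrix.nonsing_inv_mul _ hUunit)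

/-- Pattern `R2`: the explicit Hessian matrices `𝐇(y₀)`, `𝐇(y₁)`. [folklore] -/
theorem R2_mats (c : K) (P₀ P₁ : Matrix (Fin 4) (Fin 4) K)
    (hP₀ : ∀ b l, P₀ b l = (Matrix.of ![(fun _ => (1 : K)), Pi.single b 1,
      ![((1 : K) * c), ((-1 : K)), (0 : K), ((2 : K))], Pi.single l 1]).permanent)
    (hP₁ : ∀ b l, P₁ b l = (Matrix.of ![(fun _ => (1 : K)), Pi.single b 1,
      ![(0 : K), (0 : K), ((1 : K)), (0 : K)], Pi.single l 1]).permanent) :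
    P₀ = !![(0 : K), ((2 : K)), ((1 : K)), ((-1 : K)); ((2 : K)), (0 : K), ((2 : K) + (1 : K) * c), ((1 : K) * c); ((1 : K)), ((2 : K) + (1 : K) * c), (0 : K), ((-1 : K) + (1 : K) * c); ((-1 : K)), ((1 : K) * c), ((-1 : K) + (1 : K) * c), (0 : K)] ∧
    P₁ = !![(0 : K), ((1 : K)), (0 : K), ((1 : K)); ((1 : K)), (0 : K), (0 : K), ((1 : K)); (0 : K), (0 : K), (0 : K), (0 : K); ((1 : K)), ((1 : K)), (0 : K), (0 : K)] := by
  constructor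
  · ext b l; rw [hP₀, per_one_single_single]
    fin_cases b <;> fin_cases l <;> simp <;> ring
  · ext b l; rw [hP₁, per_one_single_single]
    fin_cases b <;> fin_cases l <;> simp

/-- Pattern `R2`: `det 𝐇(y₀)`. [folklore] -/
theorem R2_det (c : K) :
    (!![(0 : K), ((2 : K)), ((1 : K)), ((-1 : K)); ((2 : K)), (0 : K), ((2 : K) + (1 : K) * c), ((1 : K) * c); ((1 : K)), ((2 : K) + (1 : K) * c), (0 : K), ((-1 : K) + (1 : K) * c); ((-1 : K)), ((1 : K) * c), ((-1 : K) + (1 : K) * c), (0 : K)] : Matrix (Fin 4) (Fin 4) K).det = ((8 : K) * c + (8 : K) * c ^ 2) := by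
  rw [Matrix.det_succ_row_zero]
  simp [Fin.sum_univ_succ, Matrix.det_fin_three, Fin.succAbove]
  ring

/-- Pattern `R2`: scaled Krylov chain, step 1. [folklore] -/
theorem R2_c1 (c : K) :
    (!![(0 : K), ((2 : K)), ((1 : K)), ((-1 : K)); ((2 : K)), (0 : K), ((2 : K) + (1 : K) * c), ((1 : K) * c); ((1 : K)), ((2 : K) + (1 : K) * c), (0 : K), ((-1 : K) + (1 : K) * c); ((-1 : K)), ((1 : K) * c), ((-1 : K) + (1 : K) * c), (0 : K)] : Matrix (Fin 4) (Fin 4) K) *ᵥ ![((-10 : K) * c + (-2 : K) * c ^ 2), ((6 : K) + (-2 : K) * c), ((8 : K) * c), ((12 : K) + (4 : K) * c)]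
      = ((8 : K) * c + (8 : K) * c ^ 2) • (!![(0 : K), ((1 : K)), (0 : K), ((1 : K)); ((1 : K)), (0 : K), (0 : K), ((1 : K)); (0 : K), (0 : K), (0 : K), (0 : K); ((1 : K)), ((1 : K)), (0 : K), (0 : K)] : Matrix (Fin 4) (Fin 4) K) *ᵥ ![((1 : K)), (0 : K), (0 : K), (0 : K)] := by
  ext i; fin_cases i <;> simp
  all_goals ring

/-- Pattern `R2`: scaled Krylov chain, step 2. [folklore] -/
theorem R2_c2 (c : K) :
    (!![(0 : K), ((2 : K)), ((1 : K)), ((-1 : K)); ((2 : K)), (0 : K), ((2 : K) + (1 : K) * c), ((1 : K) * c); ((1 : K)), ((2 : K) + (1 : K) * c), (0 : K), ((-1 : K) + (1 : K) * c); ((-1 : K)), ((1 : K) * c), ((-1 : K) + (1 : K) * c), (0 : K)] : Matrix (Fin 4) (Fin 4) K) *ᵥ ![((-144 : K) * c + (136 : K) * c ^ 2 + (96 : K) * c ^ 3 + (8 : K) * c ^ 4), ((48 : K) + (-120 : K) * c + (32 : K) * c ^ 2 + (8 : K) * c ^ 3), ((144 : K) * c + (-64 : K) * c ^ 2 + (-16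 : K) * c ^ 3), ((96 : K) + (-240 : K) * c + (-160 : K) * c ^ 2 + (-16 : K) * c ^ 3)]
      = ((8 : K) * c + (8 : K) * c ^ 2) • (!![(0 : K), ((1 : K)), (0 : K), ((1 : K)); ((1 : K)), (0 : K), (0 : K), ((1 : K)); (0 : K), (0 : K), (0 : K), (0 : K); ((1 : K)), ((1 : K)), (0 : K), (0 : K)] : Matrix (Fin 4) (Fin 4) K) *ᵥ ![((-10 : K) * c + (-2 : K) * c ^ 2), ((6 : K) + (-2 : K) * c), ((8 : K) * c), ((12 : K) + (4 : K) * c)] := by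
  ext i; fin_cases i <;> simp
  all_goals ring

/-- Pattern `R2`: scaled Krylov chain, step 3. [folklore] -/
theorem R2_c3 (c : K) :
    (!![(0 : K), ((2 : K)), ((1 : K)), ((-1 : K)); ((2 : K)), (0 : K), ((2 : K) + (1 : K) * c), ((1 : K) * c); ((1 : K)), ((2 : K) + (1 : K) * c), (0 : K), ((-1 : K) + (1 : K) * c); ((-1 : K)), ((1 : K) * c), ((-1 : K) + (1 : K) * c), (0 : K)] : Matrix (Fin 4) (Fin 4) K) *ᵥ ![((-1152 : K) * c + (4608 : K) * c ^ 2 + (-928 : K) * c ^ 3 + (-2656 : K) * c ^ 4 + (-608 : K) * c ^ 5 + (-32 : K) * c ^ 6), ((384 : K) + (-2304 : K) * c + (2400 : K) * c ^ 2 + (160 : K) * c ^ 3 + (-352 : K) * c ^ 4 + (-32 : K) * c ^ 5), ((1152 : K) * c + (-4032 : K) * c ^ 2 + (64 : K) * c ^ 3 + (704 : K) * c ^ 4 + (64 : K) * c ^ 5), ((768 : K) + (-4608 : K) * c + (2496 : K) * c ^ 2 + (4288 : K) * c ^ 3 + (1088 : K) * c ^ 4 + (64 : K) * c ^ 5)]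
      = ((8 : K) * c + (8 : K) * c ^ 2) • (!![(0 : K), ((1 : K)), (0 : K), ((1 : K)); ((1 : K)), (0 : K), (0 : K), ((1 : K)); (0 : K), (0 : K), (0 : K), (0 : K); ((1 : K)), ((1 : K)), (0 : K), (0 : K)] : Matrix (Fin 4) (Fin 4) K) *ᵥ ![((-144 : K) * c + (136 : K) * c ^ 2 + (96 : K) * c ^ 3 + (8 : K) * c ^ 4), ((48 : K) + (-120 : K) * c + (32 : K) * c ^ 2 + (8 : K) * c ^ 3), ((144 : K) * c + (-64 : K) * c ^ 2 + (-16 : K) * c ^ 3), ((96 : K) + (-240 : K) * c + (-160 : K) * c ^ 2 + (-16 : K) * c ^ 3)] := by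
  ext i; fin_cases i <;> simp
  all_goals ring

/-- Pattern `R2`: the Krylov vectors form a basis. [folklore] -/
theorem R2_kdet (c : K) :
    (Matrix.of ![![((1 : K)), (0 : K), (0 : K), (0 : K)], ![((-10 : K) * c + (-2 : K) * c ^ 2), ((6 : K) + (-2 : K) * c), ((8 : K) * c), ((12 : K) + (4 : K) * c)],
      ![((-144 : K) * c + (136 : K) * c ^ 2 + (96 : K) * c ^ 3 + (8 : K) * c ^ 4), ((48 : K) + (-120 : K) * c + (32 : K) * c ^ 2 + (8 : K) * c ^ 3), ((144 : K) * c + (-64 : K) * c ^ 2 + (-16 : K) * c ^ 3), ((96 : K) + (-240 : K) * c + (-160 : K) * c ^ 2 + (-16 : K) * c ^ 3)],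
      ![((-1152 : K) * c + (4608 : K) * c ^ 2 + (-928 : K) * c ^ 3 + (-2656 : K) * c ^ 4 + (-608 : K) * c ^ 5 + (-32 : K) * c ^ 6), ((384 : K) + (-2304 : K) * c + (2400 : K) * c ^ 2 + (160 : K) * c ^ 3 + (-352 : K) * c ^ 4 + (-32 : K) * c ^ 5), ((1152 : K) * c + (-4032 : K) * c ^ 2 + (64 : K) * c ^ 3 + (704 : K) * c ^ 4 + (64 : K) * c ^ 5), ((768 : K) + (-4608 : K) * c + (2496 : K) * c ^ 2 + (4288 : K) * c ^ 3 + (1088 : K) * c ^ 4 + (64 : K) * c ^ 5)]] : Matrix (Fin 4) (Fin 4) K).det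
      = ((-49152 : K) * c ^ 3 + (-147456 : K) * c ^ 4 + (-147456 : K) * c ^ 5 + (-49152 : K) * c ^ 6) := by
  rw [Matrix.det_succ_row_zero]
  simp [Fin.sum_univ_succ, Matrix.det_fin_three, Fin.succAbove]
  ring

/-- **Residual pattern `R2`**: h = (1*c^0, 1*c^1, 0, 0) — pencil witnesses
`y₀ = ![((1 : K) * c), ((-1 : K)), (0 : K), ((2 : K))]`, `y₁ = ![(0 : K), (0 : K), ((1 : K)), (0 : K)]` (memo §2). [folklore] -/
theorem htz_R2 [CharZero K] (h : Fin 4 → K) (c : K)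
    (e0' : h 0 = 1) (e1' : h 1 = c) (e2' : h 2 = 0) (e3' : h 3 = 0) (hc0 : c ≠ 0) (hc1 : c + 1 ≠ 0)
    (P₀ P₁ : Matrix (Fin 4) (Fin 4) K)
    (hP₀ : ∀ b l, P₀ b l = (Matrix.of ![(fun _ => (1 : K)), Pi.single b 1,
      ![((1 : K) * c), ((-1 : K)), (0 : K), ((2 : K))], Pi.single l 1]).permanent)
    (hP₁ : ∀ b l, P₁ b l = (Matrix.of ![(fun _ => (1 : K)), Pi.single b 1,
      ![(0 : K), (0 : K), ((1 : K)), (0 : K)], Pi.single l 1]).permanent) :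
    (∑ k, ![((1 : K) * c), ((-1 : K)), (0 : K), ((2 : K))] k * h k = 0) ∧
    (∑ k, ![(0 : K), (0 : K), ((1 : K)), (0 : K)] k * h k = 0) ∧
    IsUnit P₀.det ∧
    (∀ A : Matrix (Fin 4) (Fin 4) K, Aᵀ = -A →
      A * (P₀⁻¹ * P₁) = (P₀⁻¹ * P₁)ᵀ * A → A = 0) := by
  obtain ⟨e0, e1⟩ := R2_mats (K := K) c P₀ P₁ hP₀ hP₁
  have hd : P₀.det = ((8 : K) * c + (8 : K) * c ^ 2) := by rw [e0]; exact R2_det (K := K) c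
  have hunit : IsUnit P₀.det := by
    rw [hd, isUnit_iff_ne_zero]
    have : (8 : K) * c + 8 * c ^ 2 = 8 * c * (c + 1) := by ring
    rw [this]; exact mul_ne_zero (mul_ne_zero (by norm_num) hc0) hc1
  refine ⟨by simp [Fin.sum_univ_four, e0', e1', e2', e3'], by simp [Fin.sum_univ_four, e0', e1', e2', e3'], hunit, ?_⟩
  have hP0inv : P₀ * P₀⁻¹ = 1 := Matrix.mul_nonsing_inv P₀ hunit
  have hP0inv' : P₀⁻¹ * P₀ = 1 := Matrix.nonsing_inv_mul P₀ hunit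
  let u : Fin 4 → Fin 4 → K := ![![((1 : K)), (0 : K), (0 : K), (0 : K)], ![((-10 : K) * c + (-2 : K) * c ^ 2), ((6 : K) + (-2 : K) * c), ((8 : K) * c), ((12 : K) + (4 : K) * c)],
    ![((-144 : K) * c + (136 : K) * c ^ 2 + (96 : K) * c ^ 3 + (8 : K) * c ^ 4), ((48 : K) + (-120 : K) * c + (32 : K) * c ^ 2 + (8 : K) * c ^ 3), ((144 : K) * c + (-64 : K) * c ^ 2 + (-16 : K) * c ^ 3), ((96 : K) + (-240 : K) * c + (-160 : K) * c ^ 2 + (-16 : K) * c ^ 3)],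
    ![((-1152 : K) * c + (4608 : K) * c ^ 2 + (-928 : K) * c ^ 3 + (-2656 : K) * c ^ 4 + (-608 : K) * c ^ 5 + (-32 : K) * c ^ 6), ((384 : K) + (-2304 : K) * c + (2400 : K) * c ^ 2 + (160 : K) * c ^ 3 + (-352 : K) * c ^ 4 + (-32 : K) * c ^ 5), ((1152 : K) * c + (-4032 : K) * c ^ 2 + (64 : K) * c ^ 3 + (704 : K) * c ^ 4 + (64 : K) * c ^ 5), ((768 : K) + (-4608 : K) * c + (2496 : K) * c ^ 2 + (4288 : K) * c ^ 3 + (1088 : K) * c ^ 4 + (64 : K) * c ^ 5)]]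
  have c1 : P₀ *ᵥ u 1 = ((8 : K) * c + (8 : K) * c ^ 2) • P₁ *ᵥ u 0 := by
    rw [e0, e1]; exact R2_c1 (K := K) c
  have c2 : P₀ *ᵥ u 2 = ((8 : K) * c + (8 : K) * c ^ 2) • P₁ *ᵥ u 1 := by
    rw [e0, e1]; exact R2_c2 (K := K) c
  have c3 : P₀ *ᵥ u 3 = ((8 : K) * c + (8 : K) * c ^ 2) • P₁ *ᵥ u 2 := by
    rw [e0, e1]; exact R2_c3 (K := K) c
  have hUunit : IsUnit (Matrix.of u).det := by
    have hD : (Matrix.of u).det = ((-49152 : K) * c ^ 3 + (-147456 : K) * c ^ 4 + (-147456 : K) * c ^ 5 + (-49152 : K) * c ^ 6) := R2_kdet (K := K) c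
    rw [hD, isUnit_iff_ne_zero]
    have : ((-49152 : K) * c ^ 3 + (-147456 : K) * c ^ 4 + (-147456 : K) * c ^ 5 + (-49152 : K) * c ^ 6) = -49152 * c ^ 3 * (c + 1) ^ 3 := by ring
    rw [this]; exact mul_ne_zero (mul_ne_zero (by norm_num) (pow_ne_zero 3 hc0)) (pow_ne_zero 3 hc1)
  intro A hA hAS
  exact eq_zero_of_pencil_chain_smul A (P₀⁻¹ * P₁) P₀ P₁ hA hAS
    (by rw [← Matrix.mul_assoc, hP0inv, Matrix.one_mul]) P₀⁻¹ hP0inv' ((8 : K) * c + (8 : K) * c ^ 2)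
    (by rw [← hd]; exact hunit.ne_zero) u c1 c2 c3 (Matrix.of u)⁻¹ (Matrix.nonsing_inv_mul _ hUunit)


end Summit.ValiantsHypothesis.ValiantsHypothesis.Theorems.SymPencilPerFourPeeledResidual

end
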